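import Literature.AlgebraicGeometry.HodgeTheory.HodgeTestFunctionals
import Literature.Analysis.Complex.HolomorphicFramesOfKernels
import Literature.Geometry.Kaehler.DiffeomorphDeRhamCohomology
import HarnessLib

/-!
# Analytic frames of the transported Hodge filtration over a chart ball
# (Voisin I, Thm. 10.9 «`F^p𝓗^k` is a holomorphic subbundle», local form on the reference fibre)

Topic: Hodge theory in families (Griffiths 1968; Voisin (2002), §10.1.2 Thm. 10.9). Theorems only,
no definition, no named fact. Written by the prover seat `hodge-nonav-prover-Bx` (g17, cell
`hodge-nonav`) as brick **K7g** of the programme «GRIFFITHS-HOLOMORPHY» (memo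
`PROGRAMME-GRIFFITHS-HOLOMORPHY-Bx-g17.md`, target
`Literature.AlgebraicGeometry.HodgeTheory.Griffiths1968_holomorphicHodgeSubbundlesQP`): the kernel
frame theorem `Literature.Analysis.Complex.exists_analyticOnNhd_frame_of_ker_of_differentiableAt`
(brick K6) applied to the Hodge bundles of a proper holomorphic submersion over a chart ball, read on
the de Rham cohomology `V = H^k_dR(X_{s₀}; ℂ)` of the reference fibre.

SETTING: the chart-ball setting of `HodgeTestFunctionals` (brick K5d) over a base modelled on
`ℂ^d = Fin d → ℂ` — proper holomorphic submersion `ϖ : 𝒳 → B`, fibre models `ι b : X b ≅ 𝒳_b` over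
`O`, the `C^∞` trivialisation `Φ` over the chart ball `D = ball (c s₀) r` with inverse chart `Λ` and
DEPENDENT fibre diffeomorphisms `e p : X s₀ ≃ X (c⁻¹ p)` (`p ∈ D`), a smooth reference metric with
orientation `o₀` on `X s₀`, and on every fibre `X (c⁻¹ z)`, `z ∈ D`, a Kähler metric `g z`, a
continuous orientation `o z` with smooth volume form compatible with `o₀` along `e z`, and Poincaré
duality `hPD` for the wedge pairing — together with the INTERFACE OF BRICK K1 (the continuous family of
harmonic projectors of `hodge-nonav-19716-p2`, stated abstractly): on a smaller ball `D₁ = ball (c s₀) r₁`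
two families of linear maps `L z, R z : V → A^k(X_{s₀}; ℂ)` into the `L²`-normed smooth forms,
continuous in `z ∈ D₁` vector by vector, with `ker (L z) = (e z)^* F^pH^k(X (c⁻¹ z))` and `R z c` the
pull-back `(e z)^*η` of a closed representative `η` of `(e z)_* c` which lies pointwise in `F^p`
whenever `L z c = 0` (for K1: `η` = the harmonic representative, `L z c` = `(e z)^*` of its
`Π^{<p}`-part); and the constancy of `dim F^pH^k(X (c⁻¹ z))` on `D₁` (brick K3).

RESULT `exists_analyticFrames_hodgeFiltration_chartBall`: on some ball `D₀ = ball (c s₀) r₀`,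
`0 < r₀ ≤ r₁`, there are maps `w_1, …, w_R : D₀ → V` whose coordinates `φ ∘ w_i` (`φ ∈ V^*`) are
analytic and whose values at every `z ∈ D₀` form a basis of `(e z)^* F^pH^k(X (c⁻¹ z)) ⊆ V`.
Proof: choose a linear isomorphism `κ : V ≃ ℂ^D`; the operator family `z ↦ L z ∘ κ⁻¹` is continuous
in operator norm (finite-dimensional source, `continuousOn_clm_apply`), its kernels
`P z = κ((e z)^*F^p)` have constant rank, and the clause `hdiff` of brick K6 holds at every `z ∈ D₁`:
brick K5d (`exists_hodgeTestFunctionals_chartBall`) supplies the test functionals `ℓ_β`, a finite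
subfamily of which already has joint kernel `P z` (`exists_linearIndependent` in the finite-dimensional
dual), and differentiates `q ↦ ℓ_β(σ q)` along every continuous `σ` with `σ q ∈ P q`, the
representing `L²`-continuous family being `a q = R q (κ⁻¹ σ q)` (`ContinuousAt.clm_apply`). Brick K6
then gives the analytic frame near `c s₀`, transported back along `κ⁻¹`.

Honest scope: local differential geometry of a proper holomorphic submersion; nothing here says HC or
any rung is proved.

## References

* C. Voisin, *Hodge Theory and Complex Algebraic Geometry I*, CUP (2002), §10.1.2 Thm. 10.9, §10.2.2.
  [VoisinHodgeI2002]
* P. Griffiths, Periods of integrals on algebraic manifolds II, Amer. J. Math. 90 (1968), Thm. 1.1.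
  [Griffiths1968PeriodsII]
-/

noncomputable section

open scoped Manifold ContDiff Topology
open Bundle Set Function Filter Module Metric Complex Finset
open Literature.Geometry.Kaehler Literature.Geometry.Manifold Literature.NumberTheory.Transcendental
open Literature.AlgebraicGeometry.Motives Literature.Analysis.Complex

namespace Literature.AlgebraicGeometry.HodgeTheory

-- The identification `TangentSpace I x = E` is an abuse of definitional equality; as in the
-- tree's form files we let `isDefEq` unfold it.
set_option backward.isDefEq.respectTransparency false

/-! ### A finite-dimensional lemma -/

section FiniteDim

variable {W : Type*} [AddCommGroup W] [Module ℂ W] [FiniteDimensional ℂ W]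

/-- In a finite-dimensional space, the joint kernel of any family of linear functionals is already
the joint kernel of finitely many of them (a maximal linearly independent subfamily spans the same
subspace of the dual). [folklore] -/
private theorem exists_fin_forall_apply_eq_zero (S : Set (Module.Dual ℂ W)) :
    ∃ (n : ℕ) (ℓ : Fin n → Module.Dual ℂ W), (∀ j, ℓ j ∈ S) ∧
      ∀ v : W, (∀ j, ℓ j v = 0) → ∀ φ ∈ S, φ v = 0 := by
  classical
  obtain ⟨b, hbS, hspan, hli⟩ := exists_linearIndependent ℂ S
  have hbfin : b.Finite := Set.finite_coe_iff.mp hli.finite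
  haveI : Fintype b := hbfin.fintype
  refine ⟨Fintype.card b, fun j ↦ ((Fintype.equivFin b).symm j).1,
    fun j ↦ hbS ((Fintype.equivFin b).symm j).2, fun v hv φ hφ ↦ ?_⟩
  have hφ' : φ ∈ Submodule.span ℂ b := by rw [hspan]; exact Submodule.subset_span hφ
  have key : ∀ ψ ∈ Submodule.span ℂ b, ψ v = 0 := by
    intro ψ hψ
    induction hψ using Submodule.span_induction with
    | mem ψ hψ =>
      have h := hv (Fintype.equivFin b ⟨ψ, hψ⟩)
      simpa only [Equiv.symm_apply_apply] using h
    | zero => rfl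
    | add ψ₁ ψ₂ _ _ h₁ h₂ => rw [LinearMap.add_apply, h₁, h₂, add_zero]
    | smul a ψ _ h => rw [LinearMap.smul_apply, h, smul_zero]
  exact key φ hφ'

end FiniteDim

/-! ### The analytic frame -/

section ChartBall

variable {EX : Type} [NormedAddCommGroup EX] [NormedSpace ℂ EX] [FiniteDimensional ℂ EX]
  [MeasurableSpace EX] [BorelSpace EX] {N : ℕ} [Fact (finrank ℝ EX = N)]
  {E𝒳 : Type} [NormedAddCommGroup E𝒳] [NormedSpace ℂ E𝒳] [FiniteDimensional ℂ E𝒳]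
  {𝒳 : Type} [TopologicalSpace 𝒳] [ChartedSpace E𝒳 𝒳] [IsManifold 𝓘(ℂ, E𝒳) ω 𝒳]
  [IsManifold 𝓘(ℝ, E𝒳) ∞ 𝒳] [T2Space 𝒳] [NormalSpace 𝒳] [SigmaCompactSpace 𝒳]
  {d : ℕ} {B : Type} [TopologicalSpace B] [ChartedSpace (Fin d → ℂ) B]
  [IsManifold 𝓘(ℂ, Fin d → ℂ) ω B] {ϖ : 𝒳 → B}

/-- **Analytic frames of the transported Hodge filtration over a chart ball** (Voisin (2002),
Thm. 10.9, local form; statement, setting and proof in the module docstring). Inputs: the chart-ball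
setting of `exists_hodgeTestFunctionals_chartBall` over a base modelled on `ℂ^d`, fibrewise Kähler data
with Poincaré duality on the ball, the abstract interface `(L, R)` of the continuous family of harmonic
projectors on `ball (c s₀) r₁` (kernel = transported `F^p`, vectorwise continuity, `F^p`-representatives),
and the constancy of `dim F^pH^k` there. Output: a ball `ball (c s₀) r₀`, `0 < r₀ ≤ r₁`, and maps
`w i : ℂ^d → H^k_dR(X s₀; ℂ)` with analytic coordinates whose values at each `z` form a basis of
`(e z)^* F^pH^k(X (c⁻¹ z))`. [cite: VoisinHodgeI2002, §10.1.2 Thm. 10.9]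
[cite: Griffiths1968PeriodsII, Thm. 1.1] -/
theorem exists_analyticFrames_hodgeFiltration_chartBall
    (hπ : IsProperHolomorphicSubmersion E𝒳 (Fin d → ℂ) ϖ) {O : Set B} {s₀ : B}
    {X : B → Type} [∀ b, TopologicalSpace (X b)] [∀ b, ChartedSpace EX (X b)]
    [∀ b, IsManifold 𝓘(ℂ, EX) ω (X b)] [∀ b, IsManifold 𝓘(ℝ, EX) ∞ (X b)]
    [∀ b, CompactSpace (X b)] [∀ b, T2Space (X b)] {ι : ∀ b, X b → 𝒳}
    (hι : ∀ b ∈ O, IsFibreEmbedding EX E𝒳 ϖ b (ι b))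
    (hdim : finrank ℂ EX + finrank ℂ (Fin d → ℂ) = finrank ℂ E𝒳)
    [RiemannianBundle (fun x : X s₀ ↦ TangentSpace 𝓘(ℝ, EX) x)]
    [IsContMDiffRiemannianBundle 𝓘(ℝ, EX) ∞ EX (fun x : X s₀ ↦ TangentSpace 𝓘(ℝ, EX) x)]
    (o₀ : (x : X s₀) → Orientation ℝ (TangentSpace 𝓘(ℝ, EX) x) (Fin N))
    (hov₀ : IsSmoothForm (riemannianVolumeForm o₀))
    {r : ℝ} {Φ : (Fin d → ℂ) → X s₀ → 𝒳} {Λ : 𝒳 → (Fin d → ℂ) × X s₀}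
    (hbt : ball (extChartAt 𝓘(ℂ, Fin d → ℂ) s₀ s₀) r ⊆ (extChartAt 𝓘(ℂ, Fin d → ℂ) s₀).target)
    (hbO : ∀ p ∈ ball (extChartAt 𝓘(ℂ, Fin d → ℂ) s₀ s₀) r, (extChartAt 𝓘(ℂ, Fin d → ℂ) s₀).symm p ∈ O)
    (hπΦ : ∀ p ∈ ball (extChartAt 𝓘(ℂ, Fin d → ℂ) s₀ s₀) r, ∀ x, ϖ (Φ p x) = (extChartAt 𝓘(ℂ, Fin d → ℂ) s₀).symm p)
    (hΦs : ContMDiffOn (𝓘(ℝ, Fin d → ℂ).prod 𝓘(ℝ, EX)) 𝓘(ℝ, E𝒳) ∞ (uncurry Φ)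
      (ball (extChartAt 𝓘(ℂ, Fin d → ℂ) s₀ s₀) r ×ˢ univ))
    (e : ∀ p ∈ ball (extChartAt 𝓘(ℂ, Fin d → ℂ) s₀ s₀) r, X s₀ ≃ₘ^∞⟮𝓘(ℝ, EX), 𝓘(ℝ, EX)⟯ X ((extChartAt 𝓘(ℂ, Fin d → ℂ) s₀).symm p))
    (he : ∀ p (hp : p ∈ ball (extChartAt 𝓘(ℂ, Fin d → ℂ) s₀ s₀) r), ∀ x, ι ((extChartAt 𝓘(ℂ, Fin d → ℂ) s₀).symm p) (e p hp x) = Φ p x)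
    (hΛs : ContMDiffOn 𝓘(ℝ, E𝒳) (𝓘(ℝ, Fin d → ℂ).prod 𝓘(ℝ, EX)) ∞ Λ
      (ϖ ⁻¹' ((extChartAt 𝓘(ℂ, Fin d → ℂ) s₀).symm '' ball (extChartAt 𝓘(ℂ, Fin d → ℂ) s₀ s₀) r)))
    (hΛΦ : ∀ p ∈ ball (extChartAt 𝓘(ℂ, Fin d → ℂ) s₀ s₀) r, ∀ x, Λ (Φ p x) = (p, x))
    {k m : ℕ} (hkm : k + (m + 1) = N) (p : ℕ)
    [FiniteDimensional ℂ (complexDeRhamCohomology EX (X s₀) k)]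
    {r₁ : ℝ} (hr₁ : 0 < r₁) (hr₁r : r₁ ≤ r)
    (g : ∀ z ∈ ball (extChartAt 𝓘(ℂ, Fin d → ℂ) s₀ s₀) r₁, ContMDiffRiemannianMetric 𝓘(ℝ, EX) ∞ EX
      (fun x : X ((extChartAt 𝓘(ℂ, Fin d → ℂ) s₀).symm z) ↦ TangentSpace 𝓘(ℝ, EX) x))
    (hg : ∀ z (hz : z ∈ ball (extChartAt 𝓘(ℂ, Fin d → ℂ) s₀ s₀) r₁), (g z hz).toRiemannianMetric.IsKaehler)
    (oz : ∀ z ∈ ball (extChartAt 𝓘(ℂ, Fin d → ℂ) s₀ s₀) r₁, (x : X ((extChartAt 𝓘(ℂ, Fin d → ℂ) s₀).symm z)) → Orientation ℝ (TangentSpace 𝓘(ℝ, EX) x) (Fin N))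
    (hozc : ∀ z (hz : z ∈ ball (extChartAt 𝓘(ℂ, Fin d → ℂ) s₀ s₀) r₁), IsContinuousOrientation (oz z hz))
    (hozv : ∀ z (hz : z ∈ ball (extChartAt 𝓘(ℂ, Fin d → ℂ) s₀ s₀) r₁),
      letI : RiemannianBundle (fun x : X ((extChartAt 𝓘(ℂ, Fin d → ℂ) s₀).symm z) ↦ TangentSpace 𝓘(ℝ, EX) x) :=
        ⟨(g z hz).toRiemannianMetric⟩
      IsSmoothForm (riemannianVolumeForm (oz z hz)))
    (hoe : ∀ z (hz : z ∈ ball (extChartAt 𝓘(ℂ, Fin d → ℂ) s₀ s₀) r₁) x, Orientation.map (Fin N)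
      ((e z (ball_subset_ball hr₁r hz)).mfderivToContinuousLinearEquiv (by simp) x).toLinearEquiv
        (o₀ x) = oz z hz (e z (ball_subset_ball hr₁r hz) x))
    (hPD : ∀ z (hz : z ∈ ball (extChartAt 𝓘(ℂ, Fin d → ℂ) s₀ s₀) r₁), ∀ θ : cclosedSmoothForms EX (X ((extChartAt 𝓘(ℂ, Fin d → ℂ) s₀).symm z)) k,
      complexDeRhamCohomology.mk EX (X ((extChartAt 𝓘(ℂ, Fin d → ℂ) s₀).symm z)) k θ ≠ 0 →
      ∃ γ : cclosedSmoothForms EX (X ((extChartAt 𝓘(ℂ, Fin d → ℂ) s₀).symm z)) (m + 1),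
        cintegral (oz z hz) (((θ : MForm 𝓘(ℝ, EX) (X ((extChartAt 𝓘(ℂ, Fin d → ℂ) s₀).symm z)) ℂ k).wedge
          (γ : MForm 𝓘(ℝ, EX) (X ((extChartAt 𝓘(ℂ, Fin d → ℂ) s₀).symm z)) ℂ (m + 1))).castDeg hkm) ≠ 0)
    {Rk : ℕ} (hrank : ∀ z ∈ ball (extChartAt 𝓘(ℂ, Fin d → ℂ) s₀ s₀) r₁, finrank ℂ ↥(⨆ pq ∈ {pq ∈ antidiagonal k | p ≤ pq.1},
              hodgePQ EX (X ((extChartAt 𝓘(ℂ, Fin d → ℂ) s₀).symm z)) k pq.1 pq.2) = Rk) :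
    haveI : Fact (IsSmoothForm (riemannianVolumeForm o₀)) := ⟨hov₀⟩
    ∀ (L R : (Fin d → ℂ) → (complexDeRhamCohomology EX (X s₀) k →ₗ[ℂ] CL2SmoothForms o₀ k)),
      (∀ c, ContinuousOn (fun z ↦ L z c) (ball (extChartAt 𝓘(ℂ, Fin d → ℂ) s₀ s₀) r₁)) →
      (∀ c, ContinuousOn (fun z ↦ R z c) (ball (extChartAt 𝓘(ℂ, Fin d → ℂ) s₀ s₀) r₁)) →
      (∀ z (hz : z ∈ ball (extChartAt 𝓘(ℂ, Fin d → ℂ) s₀ s₀) r₁), LinearMap.ker (L z) =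
        (⨆ pq ∈ {pq ∈ antidiagonal k | p ≤ pq.1},
              hodgePQ EX (X ((extChartAt 𝓘(ℂ, Fin d → ℂ) s₀).symm z)) k pq.1 pq.2).map
          (complexDeRhamCohomology.map EX (e z (ball_subset_ball hr₁r hz)).contMDiff k)) →
      (∀ z (hz : z ∈ ball (extChartAt 𝓘(ℂ, Fin d → ℂ) s₀ s₀) r₁) (c : complexDeRhamCohomology EX (X s₀) k),
        ∃ (η : MForm 𝓘(ℝ, EX) (X ((extChartAt 𝓘(ℂ, Fin d → ℂ) s₀).symm z)) ℂ k)
          (hη : η ∈ cclosedSmoothForms EX (X ((extChartAt 𝓘(ℂ, Fin d → ℂ) s₀).symm z)) k),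
          CL2SmoothForms.toForm o₀ (R z c) = η.pullback 𝓘(ℝ, EX) (e z (ball_subset_ball hr₁r hz)) ∧
          c = complexDeRhamCohomology.map EX (e z (ball_subset_ball hr₁r hz)).contMDiff k
            (complexDeRhamCohomology.mk EX (X ((extChartAt 𝓘(ℂ, Fin d → ℂ) s₀).symm z)) k ⟨η, hη⟩) ∧
          (L z c = 0 → ∀ (y : X ((extChartAt 𝓘(ℂ, Fin d → ℂ) s₀).symm z)) (r' s : ℕ), r' < p →
            typeProjAt r' s (show EX [⋀^Fin k]→L[ℝ] ℂ from η y) = 0)) →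
      ∃ r₀ : ℝ, 0 < r₀ ∧ r₀ ≤ r₁ ∧
        ∃ w : Fin Rk → (Fin d → ℂ) → complexDeRhamCohomology EX (X s₀) k,
          (∀ i (φ : Module.Dual ℂ (complexDeRhamCohomology EX (X s₀) k)),
            AnalyticOnNhd ℂ (fun z ↦ φ (w i z)) (ball (extChartAt 𝓘(ℂ, Fin d → ℂ) s₀ s₀) r₀)) ∧
          ∀ z (_ : z ∈ ball (extChartAt 𝓘(ℂ, Fin d → ℂ) s₀ s₀) r₀)
            (hzr : z ∈ ball (extChartAt 𝓘(ℂ, Fin d → ℂ) s₀ s₀) r),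
            LinearIndependent ℂ (fun i ↦ w i z) ∧
            Submodule.span ℂ (Set.range fun i ↦ w i z) =
              (⨆ pq ∈ {pq ∈ antidiagonal k | p ≤ pq.1},
              hodgePQ EX (X ((extChartAt 𝓘(ℂ, Fin d → ℂ) s₀).symm z)) k pq.1 pq.2).map
                (complexDeRhamCohomology.map EX (e z hzr).contMDiff k) := by
  haveI hF : Fact (IsSmoothForm (riemannianVolumeForm o₀)) := ⟨hov₀⟩
  intro L R hLc hRc hker hrep
  classical
  haveI : IsContinuousRiemannianBundle EX (fun x : X s₀ ↦ TangentSpace 𝓘(ℝ, EX) x) :=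
    isContinuousRiemannianBundle_of_isContMDiffRiemannianBundle 𝓘(ℝ, EX) ∞
  -- coordinates `κ : V ≃ ℂ^D` on `V = H^k_dR(X s₀; ℂ)`
  let D : ℕ := finrank ℂ (complexDeRhamCohomology EX (X s₀) k)
  let κ : complexDeRhamCohomology EX (X s₀) k ≃ₗ[ℂ] (Fin D → ℂ) := (Module.finBasis ℂ _).equivFun
  -- the transported filtration `(e z)^* F^p`, its coordinates `P z`, the operators in coordinates
  let Fp : ∀ z (_ : z ∈ ball (extChartAt 𝓘(ℂ, Fin d → ℂ) s₀ s₀) r), Submodule ℂ (complexDeRhamCohomology EX (X s₀) k) :=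
    fun z hz ↦ (⨆ pq ∈ {pq ∈ antidiagonal k | p ≤ pq.1},
        hodgePQ EX (X ((extChartAt 𝓘(ℂ, Fin d → ℂ) s₀).symm z)) k pq.1 pq.2).map
      (complexDeRhamCohomology.map EX (e z hz).contMDiff k)
  let P : (Fin d → ℂ) → Submodule ℂ (Fin D → ℂ) := fun z ↦
    if hz : z ∈ ball (extChartAt 𝓘(ℂ, Fin d → ℂ) s₀ s₀) r₁ then (Fp z (ball_subset_ball hr₁r hz)).map κ.toLinearMap else ⊥
  let Lop : (Fin d → ℂ) → (Fin D → ℂ) →L[ℂ] CL2SmoothForms o₀ k := fun z ↦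
    LinearMap.toContinuousLinearMap ((L z).comp κ.symm.toLinearMap)
  let Rop : (Fin d → ℂ) → (Fin D → ℂ) →L[ℂ] CL2SmoothForms o₀ k := fun z ↦
    LinearMap.toContinuousLinearMap ((R z).comp κ.symm.toLinearMap)
  have hU : IsOpen (ball (extChartAt 𝓘(ℂ, Fin d → ℂ) s₀ s₀) r₁) := isOpen_ball
  have hLop : ContinuousOn Lop (ball (extChartAt 𝓘(ℂ, Fin d → ℂ) s₀ s₀) r₁) :=
    continuousOn_clm_apply.2 fun y ↦ (hLc (κ.symm y)).congr fun z _ ↦ rfl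
  have hRop : ContinuousOn Rop (ball (extChartAt 𝓘(ℂ, Fin d → ℂ) s₀ s₀) r₁) :=
    continuousOn_clm_apply.2 fun y ↦ (hRc (κ.symm y)).congr fun z _ ↦ rfl
  have hPdef : ∀ z (hz : z ∈ ball (extChartAt 𝓘(ℂ, Fin d → ℂ) s₀ s₀) r₁),
      P z = (Fp z (ball_subset_ball hr₁r hz)).map κ.toLinearMap := fun z hz ↦ dif_pos hz
  have hPker : ∀ z ∈ ball (extChartAt 𝓘(ℂ, Fin d → ℂ) s₀ s₀) r₁,
      P z = LinearMap.ker (Lop z : (Fin D → ℂ) →ₗ[ℂ] CL2SmoothForms o₀ k) := by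
    intro z hz
    rw [hPdef z hz]
    ext v
    rw [LinearMap.mem_ker, Submodule.mem_map_equiv]
    change κ.symm v ∈ Fp z _ ↔ L z (κ.symm v) = 0
    rw [← LinearMap.mem_ker, hker z hz]
  have hPr : ∀ z ∈ ball (extChartAt 𝓘(ℂ, Fin d → ℂ) s₀ s₀) r₁, finrank ℂ (P z) = Rk := by
    intro z hz
    rw [hPdef z hz, LinearEquiv.finrank_map_eq]
    have hinj := complexDeRhamCohomology.map_diffeomorph_injective (e z (ball_subset_ball hr₁r hz)) k
    rw [← hrank z hz]
    exact (Submodule.equivMapOfInjective _ hinj _).finrank_eq.symm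
  -- the clause `hdiff` of the kernel frame theorem, from brick K5d
  have hdiff : ∀ t ∈ ball (extChartAt 𝓘(ℂ, Fin d → ℂ) s₀ s₀) r₁, ∃ (n : ℕ) (ℓ : Fin n → (Fin D → ℂ) →L[ℂ] ℂ),
      (∀ v, (∀ j, ℓ j v = 0) → v ∈ P t) ∧
      ∀ j, ∀ σ : (Fin d → ℂ) → (Fin D → ℂ), ContinuousAt σ t → (∀ᶠ t' in 𝓝 t, σ t' ∈ P t') →
        DifferentiableAt ℂ (fun t' ↦ ℓ j (σ t')) t := by
    intro z hz
    have hzr : z ∈ ball (extChartAt 𝓘(ℂ, Fin d → ℂ) s₀ s₀) r := ball_subset_ball hr₁r hz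
    obtain ⟨ℓ, hℓ, hsep, hdif⟩ := exists_hodgeTestFunctionals_chartBall hπ hι hdim o₀ hov₀ hbt hbO
      hπΦ hΦs e he hΛs hΛΦ hzr (g z hz) (hg z hz) (oz z hz) (hozc z hz) (hozv z hz) (hoe z hz) hkm p
      (hPD z hz)
    -- finitely many typed test functionals suffice, in coordinates
    let T : Set (Module.Dual ℂ (Fin D → ℂ)) :=
      {φ | ∃ β : cclosedSmoothForms EX (X ((extChartAt 𝓘(ℂ, Fin d → ℂ) s₀).symm z)) (m + 1),
        (∀ (y : X ((extChartAt 𝓘(ℂ, Fin d → ℂ) s₀).symm z)) (a b : ℕ), a + p ≤ finrank ℂ EX →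
          typeProjAt a b (show EX [⋀^Fin (m + 1)]→L[ℝ] ℂ from
            (β : MForm 𝓘(ℝ, EX) (X ((extChartAt 𝓘(ℂ, Fin d → ℂ) s₀).symm z)) ℂ (m + 1)) y) = 0) ∧
        φ = (ℓ β).comp κ.symm.toLinearMap}
    obtain ⟨n, ℓ', hℓ'T, hℓ'sep⟩ := exists_fin_forall_apply_eq_zero T
    choose β hβT hβeq using hℓ'T
    refine ⟨n, fun j ↦ LinearMap.toContinuousLinearMap (ℓ' j), fun v hv ↦ ?_, fun j σ hσ hσP ↦ ?_⟩
    · -- (sep)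
      rw [hPdef z hz, Submodule.mem_map_equiv]
      refine hsep (κ.symm v) fun β' hβ' ↦ ?_
      have hmem : (ℓ β').comp κ.symm.toLinearMap ∈ T := ⟨β', hβ', rfl⟩
      exact hℓ'sep v (fun j ↦ hv j) _ hmem
    · -- (diff)
      have hdj := hdif (β j) (hβT j) (fun q ↦ κ.symm (σ q)) (fun q ↦ R q (κ.symm (σ q))) ?_ ?_
      · have hfun : (fun t' ↦ (LinearMap.toContinuousLinearMap (ℓ' j)) (σ t')) =
            fun t' ↦ ℓ (β j) (κ.symm (σ t')) := by
          funext t'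
          rw [LinearMap.coe_toContinuousLinearMap', hβeq j]
          rfl
        rw [hfun]
        exact hdj
      · -- `L²`-continuity of the representatives `R q (κ⁻¹ σ q)` at `z`
        have hRz : ContinuousAt Rop z := hRop.continuousAt (hU.mem_nhds hz)
        exact (ContinuousAt.clm_apply hRz hσ).tendsto
      · -- the `F^p`-representatives, eventually
        filter_upwards [hU.mem_nhds hz, hσP] with q hq hqP
        have hqr : q ∈ ball (extChartAt 𝓘(ℂ, Fin d → ℂ) s₀ s₀) r := ball_subset_ball hr₁r hq
        obtain ⟨η, hη, hRq, hcq, htyp⟩ := hrep q hq (κ.symm (σ q))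
        have hL0 : L q (κ.symm (σ q)) = 0 := by
          rw [hPdef q hq, Submodule.mem_map_equiv] at hqP
          have hmem : κ.symm (σ q) ∈ LinearMap.ker (L q) := by rw [hker q hq]; exact hqP
          exact LinearMap.mem_ker.1 hmem
        exact ⟨hqr, η, hη, htyp hL0, hRq, hcq⟩
  -- brick K6: the analytic frame in coordinates near `c s₀`
  have ht₀ : extChartAt 𝓘(ℂ, Fin d → ℂ) s₀ s₀ ∈ ball (extChartAt 𝓘(ℂ, Fin d → ℂ) s₀ s₀) r₁ := mem_ball_self hr₁
  obtain ⟨U₀, hU₀o, ht₀U₀, hU₀sub, w', hw'an, hw'frame⟩ :=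
    exists_analyticOnNhd_frame_of_ker_of_differentiableAt (V := Fin D → ℂ) hU P Lop hLop hPker hPr
      hdiff ht₀
  obtain ⟨ρ, hρ0, hρU₀⟩ := Metric.isOpen_iff.1 hU₀o _ ht₀U₀
  refine ⟨min ρ r₁, lt_min hρ0 hr₁, min_le_right _ _, fun i z ↦ κ.symm (w' i z), ?_, ?_⟩
  · -- analytic coordinates
    intro i φ
    have hball : ball (extChartAt 𝓘(ℂ, Fin d → ℂ) s₀ s₀) (min ρ r₁) ⊆ U₀ :=
      (ball_subset_ball (min_le_left _ _)).trans hρU₀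
    have hlin : AnalyticOnNhd ℂ
        (fun y : Fin D → ℂ ↦ LinearMap.toContinuousLinearMap (φ.comp κ.symm.toLinearMap) y)
        Set.univ :=
      (LinearMap.toContinuousLinearMap (φ.comp κ.symm.toLinearMap)).analyticOnNhd _
    have hcomp := hlin.comp ((hw'an i).mono hball) (fun _ _ ↦ Set.mem_univ _)
    have hfun : (fun z ↦ φ (κ.symm (w' i z))) =
        (fun y : Fin D → ℂ ↦ LinearMap.toContinuousLinearMap (φ.comp κ.symm.toLinearMap) y) ∘
          (w' i) := by
      funext z; rfl
    rw [hfun]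
    exact hcomp
  · intro z hz hzr
    have hzU₀ : z ∈ U₀ := hρU₀ (ball_subset_ball (min_le_left _ _) hz)
    have hz₁ : z ∈ ball (extChartAt 𝓘(ℂ, Fin d → ℂ) s₀ s₀) r₁ := ball_subset_ball (min_le_right _ _) hz
    obtain ⟨hli, hspan⟩ := hw'frame z hzU₀
    refine ⟨?_, ?_⟩
    · exact hli.map' κ.symm.toLinearMap (LinearMap.ker_eq_bot.2 κ.symm.injective)
    · have h1 : Submodule.span ℂ (Set.range fun i ↦ κ.symm (w' i z)) =
          (Submodule.span ℂ (Set.range fun i ↦ w' i z)).map κ.symm.toLinearMap := by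
        rw [Submodule.map_span, ← Set.range_comp]
        rfl
      have hκ : κ.symm.toLinearMap.comp κ.toLinearMap = LinearMap.id :=
        LinearMap.ext fun v ↦ κ.symm_apply_apply v
      rw [h1, hspan, hPdef z hz₁, ← Submodule.map_comp, hκ, Submodule.map_id]

end ChartBall

end Literature.AlgebraicGeometry.HodgeTheory
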